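import Literature.Probability.Percolation.TriIface3
import HarnessLib

/-!
# The interface walk from a face: a closed arm or a cycle (three marks, frame of `A₀`)

Topic `Literature/Probability/Percolation`; family `crit-perc`. The walk of the interface machine
of `TriIface3.lean` (Bollobás–Riordan, *Percolation* (2006), Ch. 7, proof of Claim 10, p. 178,
Fig. 15), followed from a face `w` of `G` whose exit side has its white end `x` in `G` (so `x`
is a closed site): `closedArm_or_cycle₃` — **either** the left (white) cells, which are
successively equal or adjacent closed sites of `G` (`cells_next₃`), reach a site of the arc `A₀`
(the walk stops when the left cell becomes an outer cell, necessarily seen across a dart of the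
stretch `A₀`, white; or the face has no exit, which by `exists_isExit_or_isTerminal₃` happens only
at a marked site that is the closed left cell — `v₀, v₁ ∈ A₀`, or `v₂`, returned as such), giving
a closed path from `x` inside `G`; **or** the walk, a partial injective map on the finite set of
faces touching `G` (`exists_partialOrbit_end_or_return`), comes back to `w`, all faces before
having an exit and their left cells in `G` ("Suppose first that the component of `I` containing
`f` is a path … the white hexagons on the left of this path form a connected set containing `x₃`
and meeting `A₃⁺` … Suppose next that [it] is a cycle", p. 178). Theorems only.

## References

* B. Bollobás, O. Riordan, *Percolation*, Cambridge University Press (2006), Ch. 7, Claim 10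
  pp. 177–179, Fig. 15.

## Mathlib / tree

Tree: `TriIface3.lean` (the machine), `TriDiscInterface.lean` (`partialOrbit`, `oppIdx`,
`faceVertex_oppFace_succ(_succ)`), `PathIn` (`SitePaths.lean`).
-/

noncomputable section

open Finset

namespace Literature.Probability.Percolation

namespace TriMarkedDomain

variable (D : TriMarkedDomain 3)

/-! ## Following the interface from a face: steps, cells, the orbit -/

section Orbit

variable {B : Set (LatticeModels.Site 2)}

/-- After leaving `F` through its exit side one enters the opposite face through the same side,
seen from there under the index `oppIdx`; its next vertex is the left cell of the step … [folklore] -/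
theorem faceVertex_next_succ₃ (F : LatticeModels.HexVertex) :
    faceVertex (oppFace F (D.exitSide₃ B F)) (oppIdx F (D.exitSide₃ B F) + 1) = D.leftCell₃ B F :=
  faceVertex_oppFace_succ F _

/-- … and the one after is the right cell of the step. [folklore] -/
theorem faceVertex_next_succ_succ₃ (F : LatticeModels.HexVertex) :
    faceVertex (oppFace F (D.exitSide₃ B F)) (oppIdx F (D.exitSide₃ B F) + 2) = D.rightCell₃ B F :=
  faceVertex_oppFace_succ_succ F _

/-- The next face is entered through the crossed side. [folklore] -/
theorem isEntry_next₃ {F : LatticeModels.HexVertex} {j : Fin 3} (hj : D.IsExit₃ B F j) :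
    D.IsEntry₃ B (oppFace F (D.exitSide₃ B F)) (oppIdx F (D.exitSide₃ B F)) :=
  D.isEntry_oppFace₃ (D.isExit_exitSide₃ hj)

/-- **The two ways out of an entered face**: through the side after the entry side if the third
vertex is white (the right cell is kept, the left cell becomes the third vertex), through the
side before it if the third vertex is black (the left cell is kept, the right cell becomes the
third vertex). [folklore] -/
theorem exitSide_cases_of_isEntry₃ {F : LatticeModels.HexVertex} {e j : Fin 3} (hE : D.IsEntry₃ B F e)
    (hj : D.IsExit₃ B F j) :
    (D.exitSide₃ B F = e + 1 ∧ D.vcol₃ B F e = false ∧ D.leftCell₃ B F = faceVertex F e ∧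
        D.rightCell₃ B F = faceVertex F (e + 2)) ∨
      (D.exitSide₃ B F = e + 2 ∧ D.vcol₃ B F e = true ∧ D.leftCell₃ B F = faceVertex F (e + 1) ∧
        D.rightCell₃ B F = faceVertex F e) := by
  have hx := D.isExit_exitSide₃ hj
  set j' := D.exitSide₃ B F with hj'
  have hne : j' ≠ e := fun h => D.not_isExit_of_isEntry₃ hE (h ▸ hx)
  rw [isExit_iff₃] at hx
  obtain ⟨-, ht, hf⟩ := hx
  have e3 : e + 1 + 2 = e := by rw [add_assoc]; exact add_eq_left.2 (by decide)
  have e4 : e + 2 + 1 = e := by rw [add_assoc]; exact add_eq_left.2 (by decide)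
  have e5 : e + 2 + 2 = e + 1 := by rw [add_assoc]; congr 1
  have hc : j' = e + 1 ∨ j' = e + 2 := by
    revert hne; generalize j' = a; fin_cases e <;> fin_cases a <;> decide
  rcases hc with h | h
  · left
    refine ⟨h, ?_, ?_, ?_⟩
    · rw [h, e3] at hf; exact hf
    · unfold leftCell₃; rw [← hj', h, e3]
    · unfold rightCell₃; rw [← hj', h, add_assoc]; rfl
  · right
    refine ⟨h, ?_, ?_, ?_⟩
    · rw [h, e4] at ht; exact ht
    · unfold leftCell₃; rw [← hj', h, e5]
    · unfold rightCell₃; rw [← hj', h, e4]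

/-- The left cell of a step is white: a closed site, if in `G`. [folklore] -/
theorem leftCell_not_mem₃ {F : LatticeModels.HexVertex} {j : Fin 3} (hj : D.IsExit₃ B F j)
    (hG : D.leftCell₃ B F ∈ D.verts) : D.leftCell₃ B F ∉ B := by
  have h := D.vcol_leftCell₃ hj
  unfold leftCell₃ at hG ⊢
  rwa [D.vcol_eq_false_iff_of_mem₃ hG] at h

/-- The right cell of a step is black: an open site, if in `G`. [folklore] -/
theorem rightCell_mem₃ {F : LatticeModels.HexVertex} {j : Fin 3} (hj : D.IsExit₃ B F j)
    (hG : D.rightCell₃ B F ∈ D.verts) : D.rightCell₃ B F ∈ B := by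
  have h := D.vcol_rightCell₃ hj
  unfold rightCell₃ at hG ⊢
  rwa [D.vcol_eq_true_iff_of_mem₃ hG] at h

/-- The left and right cells of a step are adjacent (the ends of the crossed side). [folklore] -/
theorem adj_rightCell_leftCell₃ (F : LatticeModels.HexVertex) :
    LatticeModels.triGraph.Adj (D.rightCell₃ B F) (D.leftCell₃ B F) := by
  unfold rightCell₃ leftCell₃
  rw [show D.exitSide₃ B F + 2 = D.exitSide₃ B F + 1 + 1 by rw [add_assoc]; rfl]
  exact adj_faceVertex_succ _ _

/-- **One step of the walk, for the cells**: if the next face `F'` has an exit side too, then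
either the right cell is kept and the new left cell — the third vertex of `F'` — is adjacent to
the old one, or the left cell is kept and the new right cell is adjacent to the old one, `F'`
being the face left of the dart from the old to the new right cell, with apex the left cell. [folklore] -/
theorem cells_next₃ {F : LatticeModels.HexVertex} {j j' : Fin 3} (hj : D.IsExit₃ B F j)
    (hj' : D.IsExit₃ B (oppFace F (D.exitSide₃ B F)) j') :
    (D.rightCell₃ B (oppFace F (D.exitSide₃ B F)) = D.rightCell₃ B F ∧
        LatticeModels.triGraph.Adj (D.leftCell₃ B F) (D.leftCell₃ B (oppFace F (D.exitSide₃ B F)))) ∨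
      (D.leftCell₃ B (oppFace F (D.exitSide₃ B F)) = D.leftCell₃ B F ∧
        LatticeModels.triGraph.Adj (D.rightCell₃ B F) (D.rightCell₃ B (oppFace F (D.exitSide₃ B F))) ∧
        oppFace F (D.exitSide₃ B F) = leftFace (D.rightCell₃ B F) (D.rightCell₃ B (oppFace F (D.exitSide₃ B F))) ∧
        triLeftApex (D.rightCell₃ B F) (D.rightCell₃ B (oppFace F (D.exitSide₃ B F))) = D.leftCell₃ B F) := by
  have hp := D.faceVertex_next_succ₃ (B := B) F
  have hq := D.faceVertex_next_succ_succ₃ (B := B) F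
  have e30 : ∀ e : Fin 3, e + 2 + 1 = e := fun e => by rw [add_assoc]; exact add_eq_left.2 (by decide)
  have e31 : ∀ e : Fin 3, e + 2 + 2 = e + 1 := fun e => by rw [add_assoc]; congr 1
  rcases D.exitSide_cases_of_isEntry₃ (D.isEntry_next₃ hj) hj' with ⟨-, -, hl, hr⟩ | ⟨-, -, hl, hr⟩
  · left
    refine ⟨hr.trans hq, ?_⟩
    rw [hl, ← hp]
    exact (adj_faceVertex_succ _ _).symm
  · right
    refine ⟨hl.trans hp, ?_, ?_, ?_⟩
    · rw [hr, ← hq]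
      have := adj_faceVertex_succ (oppFace F (D.exitSide₃ B F)) (oppIdx F (D.exitSide₃ B F) + 2)
      rwa [e30] at this
    · rw [hr, ← hq]
      have := leftFace_faceVertex (oppFace F (D.exitSide₃ B F)) (oppIdx F (D.exitSide₃ B F) + 2)
      rw [e30] at this
      exact this.symm
    · rw [hr, ← hq, ← hp]
      have := triLeftApex_faceVertex (oppFace F (D.exitSide₃ B F)) (oppIdx F (D.exitSide₃ B F) + 2)
      rwa [e30, e31] at this


omit D in
/-- **A partial injective map on a finite set, iterated, terminates or returns to its start**:
either some orbit point has no successor, all earlier ones being defined, or the orbit comes back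
to the start, all points before being defined. [folklore] -/
theorem exists_partialOrbit_end_or_return {α : Type*} [DecidableEq α] (f : α → Option α) (S : Finset α)
    (s₀ : α) (h₀ : s₀ ∈ S) (hS : ∀ x ∈ S, ∀ y, f x = some y → y ∈ S)
    (hinj : ∀ x ∈ S, ∀ x' ∈ S, ∀ y, f x = some y → f x' = some y → x = x') :
    (∃ n, (∀ k < n, f (partialOrbit f s₀ k) = some (partialOrbit f s₀ (k + 1))) ∧
        f (partialOrbit f s₀ n) = none) ∨
      (∃ N, 0 < N ∧ (∀ k < N, f (partialOrbit f s₀ k) = some (partialOrbit f s₀ (k + 1))) ∧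
        partialOrbit f s₀ N = s₀) := by
  by_contra hno
  rw [not_or] at hno
  obtain ⟨hno1, hno2⟩ := hno
  push Not at hno1 hno2
  -- then the orbit is defined forever
  have hdef : ∀ n, f (partialOrbit f s₀ n) = some (partialOrbit f s₀ (n + 1)) := by
    intro n
    induction n using Nat.strong_induction_on with
    | _ n ih =>
      have hn := hno1 n (fun k hk => ih k hk)
      obtain ⟨y, hy⟩ := Option.ne_none_iff_exists'.1 hn
      rw [hy]
      simp [partialOrbit, hy]
  have hmem : ∀ n, partialOrbit f s₀ n ∈ S := by
    intro n
    induction n with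
    | zero => exact h₀
    | succ n ih => exact hS _ ih _ (hdef n)
  -- injectivity of the orbit
  have horb : ∀ i j, i < j → partialOrbit f s₀ i = partialOrbit f s₀ j → False := by
    intro i
    induction i with
    | zero =>
      intro j hj h
      exact hno2 j hj (fun k _ => hdef k) h.symm
    | succ i ih =>
      intro j hj h
      obtain ⟨j, rfl⟩ : ∃ j', j = j' + 1 := ⟨j - 1, by omega⟩
      have h' := hdef j
      rw [← h] at h'
      have := hinj _ (hmem i) _ (hmem j) _ (hdef i) h'
      exact ih j (by omega) this
  -- pigeonhole
  have hcard := card_le_card (show (range (#S + 1)).image (partialOrbit f s₀) ⊆ S from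
    fun x hx => by obtain ⟨n, -, rfl⟩ := mem_image.1 hx; exact hmem n)
  rw [card_image_of_injective _ (fun i j h => by
      rcases lt_trichotomy i j with hij | rfl | hij
      · exact (horb i j hij h).elim
      · rfl
      · exact (horb j i hij h.symm).elim), card_range] at hcard
  omega


/-- Two partial maps agreeing along a defined stretch of the orbit of one have the same orbit
there: if `g ≤ f` (every value of `g` is the value of `f`) then the `g`-orbit, as long as it is
defined, is the `f`-orbit. [folklore] -/
theorem partialOrbit_eq_of_le {α : Type*} {f g : α → Option α} (hle : ∀ x y, g x = some y → f x = some y)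
    (s₀ : α) {n : ℕ} (hdef : ∀ k < n, g (partialOrbit g s₀ k) = some (partialOrbit g s₀ (k + 1))) :
    ∀ k ≤ n, partialOrbit g s₀ k = partialOrbit f s₀ k := by
  intro k
  induction k with
  | zero => intro; rfl
  | succ k ih =>
    intro hk
    have e := ih (by omega)
    have h1 := hdef k (by omega)
    have h2 := hle _ _ h1
    rw [e] at h2
    show (g (partialOrbit g s₀ k)).getD s₀ = (f (partialOrbit f s₀ k)).getD s₀
    rw [h1, h2]

/-- `v₁` lies on the arc `A₀` (the dart before its marked dart is the last dart of `A₀`). [folklore] -/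
theorem markSite_one_mem_arc_zero : D.markSite 1 ∈ D.arc 0 := by
  have hL := D.isTriDisc.card_pos
  have h01 := D.pos_lt_pos₃ (show (0 : Fin 3) < 1 by decide)
  have hz : D.pos 0 = 0 := D.pos_zero (by decide)
  have key := D.iter_fst_mem_arc₃ (D.pos 1 + (#(triBdryDarts D.verts) - 1))
  rw [D.mark_pred 1] at key
  have hs : D.stretchIdx₃ (D.pos 1 + (#(triBdryDarts D.verts) - 1)) = 0 := by
    unfold stretchIdx₃
    have e : (D.pos 1 + (#(triBdryDarts D.verts) - 1)) % #(triBdryDarts D.verts) = D.pos 1 - 1 := by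
      rw [show D.pos 1 + (#(triBdryDarts D.verts) - 1) = D.pos 1 - 1 + #(triBdryDarts D.verts) by omega,
        Nat.add_mod_right, Nat.mod_eq_of_lt (by have := D.pos_lt 1; omega)]
    rw [e, if_pos (by omega)]
  rw [hs] at key
  exact key

/-- **Following the interface from a face of `G` whose left cell is in `G`: a closed arm, or a
cycle.** Start at a face `w` with an exit side whose left cell `x` (white, so closed) is a site
of `G`, and follow `ifaceNext₃` as long as the left cell stays in `G`. Either the walk stops —
the left cell becomes an outer (white) cell, seen across a dart of the stretch `A₀` from the
previous left cell, which is then a closed site of `A₀`; or the face has no exit, which only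
happens at a marked site that is the (closed) left cell: `v₀, v₁ ∈ A₀`, or `v₂` — and in all
cases the left cells form a closed path from `x`; or the walk comes back to `w`, every face
before having an exit and its left cell in `G`, closed, joined to `x` by the closed left cells
(Bollobás–Riordan 2006, p. 178: "Suppose first that the component of `I` containing `f` is a
path … the white hexagons on the left of this path form a connected set containing `x₃` and
meeting `A₃⁺` … Suppose next that [it] is a cycle"). [cite: BollobasRiordan2006, Ch. 7 Claim 10 p. 178] -/
theorem closedArm_or_cycle₃ (B : Set (LatticeModels.Site 2)) {w : LatticeModels.HexVertex} {j₀ : Fin 3}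
    (hw : D.IsExit₃ B w j₀) (hxG : D.leftCell₃ B w ∈ D.verts) :
    (∃ p, (p ∈ D.arc 0 ∨ p = D.markSite 2) ∧
        PathIn LatticeModels.triGraph ((D.verts : Set (LatticeModels.Site 2)) ∩ Bᶜ) (D.leftCell₃ B w) p) ∨
      (∃ N, 0 < N ∧ partialOrbit (D.ifaceNext₃ B) w N = w ∧
        ∀ k < N, (∃ j, D.IsExit₃ B (partialOrbit (D.ifaceNext₃ B) w k) j) ∧
          D.ifaceNext₃ B (partialOrbit (D.ifaceNext₃ B) w k) = some (partialOrbit (D.ifaceNext₃ B) w (k + 1)) ∧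
          D.leftCell₃ B (partialOrbit (D.ifaceNext₃ B) w k) ∈ D.verts ∧
          PathIn LatticeModels.triGraph ((D.verts : Set (LatticeModels.Site 2)) ∩ Bᶜ) (D.leftCell₃ B w)
            (D.leftCell₃ B (partialOrbit (D.ifaceNext₃ B) w k))) := by
  classical
  -- the walk, stopped when the left cell leaves `G`
  set g : LatticeModels.HexVertex → Option LatticeModels.HexVertex :=
    fun F => if D.leftCell₃ B F ∈ D.verts then D.ifaceNext₃ B F else none with hg
  have hgf : ∀ F y, g F = some y → D.leftCell₃ B F ∈ D.verts ∧ D.ifaceNext₃ B F = some y := by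
    intro F y h
    simp only [hg] at h
    split_ifs at h with hc
    exact ⟨hc, h⟩
  have hle : ∀ F y, g F = some y → D.ifaceNext₃ B F = some y := fun F y h => (hgf F y h).2
  set x := D.leftCell₃ B w with hxdef
  have hxB : x ∉ B := D.leftCell_not_mem₃ hw hxG
  have hwS : w ∈ triFacesTouching D.verts := by
    rw [mem_triFacesTouching]
    exact ⟨x, hxG, faceVertex_mem _ _⟩
  set orb := partialOrbit g w with horb
  -- along a defined stretch: exits, next faces, left cells in `G` joined to `x`
  have inv : ∀ n, (∀ k < n, g (orb k) = some (orb (k + 1))) → ∀ k < n,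
      D.leftCell₃ B (orb k) ∈ D.verts ∧ D.ifaceNext₃ B (orb k) = some (orb (k + 1)) ∧
      (∃ j, D.IsExit₃ B (orb k) j) ∧ orb (k + 1) = oppFace (orb k) (D.exitSide₃ B (orb k)) ∧
      PathIn LatticeModels.triGraph ((D.verts : Set (LatticeModels.Site 2)) ∩ Bᶜ) x (D.leftCell₃ B (orb k)) := by
    intro n hdef
    have hstep : ∀ k < n, D.leftCell₃ B (orb k) ∈ D.verts ∧ D.ifaceNext₃ B (orb k) = some (orb (k + 1)) :=
      fun k hk => hgf _ _ (hdef k hk)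
    have hexit : ∀ k < n, ∃ j, D.IsExit₃ B (orb k) j := by
      intro k hk
      obtain ⟨j, hj, -⟩ := D.ifaceNext_eq_some₃ (hstep k hk).2
      exact ⟨j, hj⟩
    have hnext : ∀ k < n, orb (k + 1) = oppFace (orb k) (D.exitSide₃ B (orb k)) := by
      intro k hk
      obtain ⟨j, hj⟩ := hexit k hk
      have := D.ifaceNext_eq_some_oppFace₃ hj
      rw [(hstep k hk).2] at this
      exact Option.some_injective _ this
    have hpath : ∀ k < n, PathIn LatticeModels.triGraph ((D.verts : Set (LatticeModels.Site 2)) ∩ Bᶜ) x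
        (D.leftCell₃ B (orb k)) := by
      intro k
      induction k with
      | zero => intro _; exact PathIn.refl ⟨mem_coe.2 hxG, hxB⟩
      | succ k ih =>
        intro hk
        have ih' := ih (by omega)
        obtain ⟨j, hj⟩ := hexit k (by omega)
        obtain ⟨j', hj'⟩ := hexit (k + 1) hk
        rw [hnext k (by omega)] at hj' ⊢
        have hG' : D.leftCell₃ B (oppFace (orb k) (D.exitSide₃ B (orb k))) ∈ D.verts := by
          have := (hstep (k + 1) hk).1; rwa [hnext k (by omega)] at this
        rcases D.cells_next₃ hj hj' with ⟨-, hadj⟩ | ⟨hl, -⟩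
        · exact ih'.trans (PathIn.of_adj ih'.right_mem ⟨mem_coe.2 hG', D.leftCell_not_mem₃ hj' hG'⟩ hadj)
        · rw [hl]; exact ih'
    exact fun k hk => ⟨(hstep k hk).1, (hstep k hk).2, hexit k hk, hnext k hk, hpath k hk⟩
  rcases exists_partialOrbit_end_or_return g (triFacesTouching D.verts) w hwS
      (fun F _ y hy => D.ifaceNext_mem₃ (hle F y hy))
      (fun F _ F' _ y hy hy' => D.ifaceNext_injective₃ (hle F y hy) (hle F' y hy')) with
    ⟨n, hdef, hend⟩ | ⟨N, hN, hdef, hret⟩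
  · -- the walk stops at step `n ≥ 1`
    left
    have hinv := inv n hdef
    have hn : n ≠ 0 := by
      rintro rfl
      have : g w = D.ifaceNext₃ B w := by simp only [hg]; rw [if_pos hxG]
      change g w = none at hend
      rw [this] at hend
      exact D.ifaceNext_ne_none₃ hw hend
    obtain ⟨m, rfl⟩ : ∃ m, n = m + 1 := ⟨n - 1, by omega⟩
    obtain ⟨hmG, -, ⟨j, hj⟩, hF'eq, hpm⟩ := hinv m (by omega)
    set F := orb m with hF
    have hend' : g (oppFace F (D.exitSide₃ B F)) = none := by rw [← hF'eq]; exact hend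
    clear hend
    have hE := D.isEntry_next₃ hj
    have hp := D.faceVertex_next_succ₃ (B := B) F
    set F' := oppFace F (D.exitSide₃ B F) with hF'
    set e := oppIdx F (D.exitSide₃ B F) with he
    by_cases hex : ∃ j', D.IsExit₃ B F' j'
    · -- `F'` has an exit, so its left cell is out of `G`: an outer cell across a dart of `A₀`
      obtain ⟨j', hj'⟩ := hex
      have hout : D.leftCell₃ B F' ∉ D.verts := by
        intro hin
        have : g F' = D.ifaceNext₃ B F' := by simp only [hg]; rw [if_pos hin]
        rw [this] at hend'
        exact D.ifaceNext_ne_none₃ hj' hend'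
      rcases D.exitSide_cases_of_isEntry₃ hE hj' with ⟨-, hcol, hl, -⟩ | ⟨-, -, hl, -⟩
      · have hmout : faceVertex F' e ∉ D.verts := by rw [← hl]; exact hout
        have hview : D.vcol₃ B F' e = D.bdryCol₃ (D.dpos (faceVertex F' (e + 1), faceVertex F' e)) := by
          unfold vcol₃; rw [if_neg hmout, if_pos (by rw [hp]; exact hmG)]
        rw [hview, hp] at hcol
        have hd : (D.leftCell₃ B F, faceVertex F' e) ∈ triBdryDarts D.verts :=
          mem_triBdryDarts.2 ⟨hmG, hmout, by rw [← hp]; exact (adj_faceVertex_succ F' e).symm⟩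
        have hs0 : D.stretchIdx₃ (D.dpos (D.leftCell₃ B F, faceVertex F' e)) = 0 := by
          unfold bdryCol₃ bcolOf₃ at hcol
          simpa using hcol
        have harc := D.iter_fst_mem_arc₃ (D.dpos (D.leftCell₃ B F, faceVertex F' e))
        rw [D.iter_dpos hd, hs0] at harc
        exact ⟨_, Or.inl harc, hpm⟩
      · exact absurd (by rw [hl, hp]; exact hmG) hout
    · -- no exit: `F'` is terminal, at a marked site which is the (closed) left cell
      rcases D.exists_isExit_or_isTerminal₃ hE with hex' | hT
      · exact absurd hex' hex
      · obtain ⟨i, v, hmark, hT⟩ := hT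
        rcases hT with ⟨hev, -, -, -, -⟩ | ⟨hev, -, -, hout, -⟩
        · -- type 1: `v = e + 1`, the left cell is `vᵢ`
          have hv : v = e + 1 := by rw [hev, add_assoc]; exact (add_eq_left.2 (by decide)).symm
          rw [hv, hp] at hmark
          refine ⟨_, ?_, hpm⟩
          fin_cases i
          · exact Or.inl (hmark ▸ D.markSite_mem_arc 0)
          · exact Or.inl (hmark ▸ D.markSite_one_mem_arc_zero)
          · exact Or.inr hmark
        · -- type 2: the left cell would be out of `G`
          have hv : v + 2 = e + 1 := by rw [hev, add_assoc]; rfl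
          rw [hv, hp] at hout
          exact absurd hmG hout
  · -- the walk closes up
    right
    have hinv := inv N hdef
    have heq := partialOrbit_eq_of_le hle w hdef
    have hret' : partialOrbit (D.ifaceNext₃ B) w N = w := by rw [← heq N le_rfl]; exact hret
    refine ⟨N, hN, hret', fun k hk => ?_⟩
    obtain ⟨hG, hnx, hex, -, hpa⟩ := hinv k hk
    have e1 : orb k = partialOrbit (D.ifaceNext₃ B) w k := heq k hk.le
    have e2 : orb (k + 1) = partialOrbit (D.ifaceNext₃ B) w (k + 1) := heq (k + 1) hk
    rw [e1] at hG hnx hex hpa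
    rw [e2] at hnx
    exact ⟨hex, hnx, hG, hpa⟩

end Orbit

end TriMarkedDomain

end Literature.Probability.Percolation
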